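import Summits.HodgeConjecture.CorCM.ImaginaryQuadraticTimesSimpleCMSurfaceHodge
import Summits.HodgeConjecture.CorCM.QuadraticCMFamiliesHodge
import Literature.AlgebraicGeometry.Pohlmann1968.SeparatingCMFamilies
import Literature.AlgebraicGeometry.Pohlmann1968.CMTypeRankLowerBoundsNumberField
import Literature.NumberTheory.ComplexMultiplication.CMTypeLattice
import HarnessLib

/-!
# CM algebras of degree `≤ 6`: every PRIMITIVE (separating) CM type is NONDEGENERATE — CM abelian varieties of
# total dimension `≤ 3` built from simple, pairwise non-isogenous factors are stably nondegenerate

COR-CM (cell `pub-hodgecm2`, seat `b16` gen 36, count-neutral claim CM-DIMLE3-STABLE, file 2; theorems only, no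
definition, no named fact).  NEW as stated (a combination), hence under `Summits/`.

For ONE CM field `K` of degree `[K:ℚ] ≤ 6` the tree has Ribet's bound `isNondegenerate_of_isPrimitive_of_finrank_le_six`
(primitive ⟹ nondegenerate: degenerate primitive CM types first occur in degree `8`).  Here the same is proved for a CM
ALGEBRA `E = ∏_i K_i` of degree `[E:ℚ] = Σ_i [K_i:ℚ] ≤ 6` and Deligne's CM type `Σ = ⊔_i Φ_i` of `E`
(`CMAlgebra.familyType`): if `Σ` is primitive in Kubota's sense (`CMAlgebra.IsSeparatingFamily Φ`: the `Aut(ℂ)`-translates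
of `Σ` separate `⊔_i Hom(K_i, ℂ)`; ⟺ every `Φ_i` primitive and no two members CM-equivalent,
`CMAlgebra.isSeparatingFamily_iff`) then it is nondegenerate (`CMAlgebra.IsNondegenerateFamily Φ`: Deligne's rank
`= Σ_i [K_i:ℚ]/2 + 1`, i.e. `dim Hg(∏_i A_{Φ_i}) = Σ_i dim A_{Φ_i}` — Gordon 7.5 (3), STABLE NONDEGENERACY).  Degenerate
separating families of a CM algebra first occur in degree `8` too (`K` sextic `⊃ k` imaginary quadratic, `E = K × k`:
Moonen–Zarhin's case (a), `A × E` of dimension `4`; or `E = K` octic).  The proof is the case list of Moonen–Zarhin 1999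
(5.2) «Suppose `g = 3` …; for every complex abelian variety `X` of dimension `≤ 3` we have `Hg(X) = Sp_D(V,φ)` and
condition (D) is satisfied», for CM varieties and in CM-type combinatorics, every case BY NAME a tree theorem:

* one slot, `[K:ℚ] ∈ {2, 4, 6}`: `isNondegenerate_of_isPrimitive_of_finrank_le_six` (Ribet / Dodson 1.0, Yanai);
* all slots quadratic (`(2,2)`, `(2,2,2)`: products of pairwise non-isogenous CM elliptic curves):
  `isNondegenerateFamily_of_finrank_eq_two` (seat b23/b16, Moonen–Zarhin Cor. (3.9), Imai);
* `(2,4)` (CM elliptic curve × simple CM abelian surface): `isNondegenerateFamily_of_quadratic_of_isPrimitive` (seat p2,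
  Moonen–Zarhin (5.2): «the center of `End⁰(X₂)` does not contain an imaginary quadratic field»).

Contents:
* §1 **`isNondegenerateFamily_of_isSeparatingFamily_of_sum_finrank_le_six`**, and the equivalence
  `isNondegenerateFamily_iff_isSeparatingFamily_of_sum_finrank_le_six` (⟹ is Kubota, `IsNondegenerateFamily.isSeparatingFamily`);
* §2 for realisations `(A_i, ι_i, θ_i)` of the `(K_i; Φ_i)`: `Bᵐ ⊗ ℂ = Dᵐ ⊗ ℂ` and the Hodge conjecture on EVERY product
  `⨁_{j<N} A_{π j}` (all `∏_i A_i^{k_i}`) of a separating family of total degree `≤ 6`; and the same under the GEOMETRIC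
  hypotheses «`A_i` SIMPLE, PAIRWISE NON-ISOGENOUS, `Σ_i dim A_i ≤ 3`» (through
  `CMAlgebra.isSeparatingFamily_of_isSimple_of_pairwise_not_isIsogenous`):
  **`isNondegenerateFamily_of_isSimple_of_pairwise_not_isIsogenous_of_sum_dim_le_three`**,
  **`hodgeConjectureFor_prod_of_isSimple_of_pairwise_not_isIsogenous_of_sum_dim_le_three`** — UNCONDITIONAL.

The passage from an arbitrary complex abelian variety of CM type of dimension `≤ 3` (and its powers) to such a family is
the sequel `CorCM/CMAbelianVarietyDimLeThreePowers`.

## References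

* [MoonenZarhin1999LowDim] B. Moonen, Yu. Zarhin, *Hodge classes on abelian varieties of low dimension*, Math. Ann. 315
  (1999) 711–733, §3 Cor. (3.9), §5 (5.1)–(5.2).
* [Gordon1999HodgeAVSurvey] B. B. Gordon, *A survey of the Hodge conjecture for abelian varieties*, §3 Theorem, 6.3 Remark,
  7.4–7.6.1, 10.10.
* [Shimura1998] G. Shimura, *Abelian Varieties with Complex Multiplication and Modular Functions*, §8.2 Prop. 26, §8.4 (2).
-/

noncomputable section

open CategoryTheory CategoryTheory.Limits NumberField
open scoped BigOperators

namespace Summit.HodgeConjecture.CorCM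

open Literature.NumberTheory.ComplexMultiplication
open Literature.AlgebraicGeometry.Motives (AbelianVariety CMType)
open Literature.AlgebraicGeometry.HodgeTheory
open Literature.AlgebraicGeometry.ComplexMultiplication (IsCMTypeRealisation)
open Literature.AlgebraicGeometry.VanGeemen1994 (hodgeClassSpan)
open Literature.AlgebraicGeometry.Pohlmann1968
open Literature.Barriers.HodgeConjecture (divisorClassesSpan)

/-! ## §1 Separating families of total degree `≤ 6` are nondegenerate -/

section TypeLevel

variable {I : Type} {K : I → Type} [∀ i, Field (K i)] [∀ i, NumberField (K i)] [∀ i, IsCMField (K i)] [Fintype I]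
  [Nonempty I] {Φ : ∀ i, CMType (K i)}

omit [Fintype I] [Nonempty I] [∀ i, IsCMField (K i)] in
/-- A field carrying a CM type has even degree `2n ≥ 2` (it is totally complex). [folklore] -/
private theorem exists_finrank_eq_two_mul (Φ : ∀ i, CMType (K i)) (i : I) :
    ∃ n : ℕ, 0 < n ∧ Module.finrank ℚ (K i) = 2 * n := by
  haveI := CMTypeLattice.isTotallyComplex_of_cmType (Φ i)
  have hK2 : Module.finrank ℚ (K i) = 2 * InfinitePlace.nrComplexPlaces (K i) := by
    rw [← InfinitePlace.card_add_two_mul_card_eq_rank, IsTotallyComplex.nrRealPlaces_eq_zero, zero_add]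
  have hpos : 0 < Module.finrank ℚ (K i) := Module.finrank_pos
  exact ⟨InfinitePlace.nrComplexPlaces (K i), by omega, hK2⟩

/-- **In a CM algebra of degree `≤ 6` every separating family of CM types is nondegenerate** (CM-type form of
Moonen–Zarhin 1999 (5.2) «for every complex abelian variety `X` of dimension `≤ 3` we have `Hg(X) = Sp_D(V,φ)` and
condition (D) is satisfied»): with `d_i = [K_i:ℚ]` even, `≥ 2`, and `Σ_i d_i ≤ 6`, either all `d_i = 2` (pairwise
non-isomorphic imaginary quadratic fields, `isNondegenerateFamily_of_finrank_eq_two`), or one slot has `d = 4` or `6`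
and then the family is `(4)`, `(6)` (Ribet's bound `isNondegenerate_of_isPrimitive_of_finrank_le_six`) or `(2,4)`
(`isNondegenerateFamily_of_quadratic_of_isPrimitive`); primitivity of the members from `IsSeparatingFamily.isPrimitive`.
[cite: MoonenZarhin1999LowDim, §5 (5.2) and Cor. (3.9)] [cite: Gordon1999HodgeAVSurvey, 7.5] -/
theorem isNondegenerateFamily_of_isSeparatingFamily_of_sum_finrank_le_six (hsep : CMAlgebra.IsSeparatingFamily Φ)
    (h6 : ∑ i, Module.finrank ℚ (K i) ≤ 6) : CMAlgebra.IsNondegenerateFamily Φ := by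
  classical
  have hd := exists_finrank_eq_two_mul Φ
  have hle : ∀ i, Module.finrank ℚ (K i) ≤ ∑ j, Module.finrank ℚ (K j) := fun i =>
    Finset.single_le_sum (fun j _ => Nat.zero_le (Module.finrank ℚ (K j))) (Finset.mem_univ i)
  by_cases hall : ∀ i, Module.finrank ℚ (K i) = 2
  · exact isNondegenerateFamily_of_finrank_eq_two hall hsep
  push Not at hall
  obtain ⟨i₁, hi₁⟩ := hall
  have h4 : 4 ≤ Module.finrank ℚ (K i₁) := by obtain ⟨n, hn, h⟩ := hd i₁; omega
  -- any other slot `j` satisfies `d_j + d_{i₁} ≤ 6`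
  have hrest : ∀ j, j ≠ i₁ → Module.finrank ℚ (K j) + Module.finrank ℚ (K i₁) ≤ 6 := fun j hj => by
    have h1 := Finset.add_sum_erase Finset.univ (fun i => Module.finrank ℚ (K i)) (Finset.mem_univ i₁)
    have h2 : Module.finrank ℚ (K j) ≤ ∑ i ∈ Finset.univ.erase i₁, Module.finrank ℚ (K i) :=
      Finset.single_le_sum (fun i _ => Nat.zero_le (Module.finrank ℚ (K i))) (Finset.mem_erase.2 ⟨hj, Finset.mem_univ j⟩)
    omega
  -- and there is at most one other slot
  have htwo : ∀ j j', j ≠ i₁ → j' ≠ i₁ → j ≠ j' → False := fun j j' hj hj' hjj' => by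
    have h1 := Finset.add_sum_erase Finset.univ (fun i => Module.finrank ℚ (K i)) (Finset.mem_univ i₁)
    have h2 := Finset.add_sum_erase (Finset.univ.erase i₁) (fun i => Module.finrank ℚ (K i))
      (Finset.mem_erase.2 ⟨hj, Finset.mem_univ j⟩)
    have h3 : Module.finrank ℚ (K j') ≤ ∑ i ∈ (Finset.univ.erase i₁).erase j, Module.finrank ℚ (K i) :=
      Finset.single_le_sum (fun i _ => Nat.zero_le (Module.finrank ℚ (K i)))
        (Finset.mem_erase.2 ⟨hjj'.symm, Finset.mem_erase.2 ⟨hj', Finset.mem_univ j'⟩⟩)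
    obtain ⟨n, hn, hjn⟩ := hd j
    obtain ⟨n', hn', hjn'⟩ := hd j'
    omega
  by_cases hsub : ∀ j, j = i₁
  · -- one slot of degree `4` or `6`
    haveI : Subsingleton I := ⟨fun a b => (hsub a).trans (hsub b).symm⟩
    letI : Unique I := uniqueOfSubsingleton i₁
    obtain ⟨φ₀⟩ : Nonempty (K default →+* ℂ) := inferInstance
    exact (CMAlgebra.isNondegenerateFamily_iff_isNondegenerate Φ).2
      (isNondegenerate_of_isPrimitive_of_finrank_le_six (Φ default) (le_trans (hle _) h6) φ₀ (hsep.isPrimitive _ φ₀))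
  · -- two slots `(2, 4)`
    push Not at hsub
    obtain ⟨i₀, hi₀⟩ := hsub
    have hI : ∀ j, j = i₀ ∨ j = i₁ := fun j => by
      by_contra h
      push Not at h
      exact htwo j i₀ h.2 hi₀ h.1
    have h0 : Module.finrank ℚ (K i₀) = 2 := by
      have := hrest i₀ hi₀; obtain ⟨n, hn, h⟩ := hd i₀; omega
    have h4' : Module.finrank ℚ (K i₁) = 4 := by
      have := hrest i₀ hi₀; obtain ⟨n, hn, h⟩ := hd i₁; omega
    obtain ⟨φ₀⟩ : Nonempty (K i₁ →+* ℂ) := inferInstance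
    exact isNondegenerateFamily_of_quadratic_of_isPrimitive hi₀ hI h0 h4' (hsep.isPrimitive i₁ φ₀)

/-- **In a CM algebra of degree `≤ 6`: nondegenerate ⟺ separating** (⟹ is Kubota's separation for families,
`IsNondegenerateFamily.isSeparatingFamily`, valid in every degree; ⟸ is the theorem above and FAILS from degree `8` on).
[cite: MoonenZarhin1999LowDim, §5 (5.2)] [cite: Kubota1965, §2 (p. 115)] -/
theorem isNondegenerateFamily_iff_isSeparatingFamily_of_sum_finrank_le_six (h6 : ∑ i, Module.finrank ℚ (K i) ≤ 6)
    (Φ : ∀ i, CMType (K i)) : CMAlgebra.IsNondegenerateFamily Φ ↔ CMAlgebra.IsSeparatingFamily Φ :=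
  ⟨fun h => h.isSeparatingFamily, fun h => isNondegenerateFamily_of_isSeparatingFamily_of_sum_finrank_le_six h h6⟩

/-- **Degree `≤ 6`: nondegenerate ⟺ every member primitive and no two members CM-equivalent** (with
`CMAlgebra.isSeparatingFamily_iff`). [cite: MoonenZarhin1999LowDim, §5 (5.2)] [cite: Gordon1999HodgeAVSurvey, 7.4–7.5] -/
theorem isNondegenerateFamily_iff_isPrimitive_of_sum_finrank_le_six (h6 : ∑ i, Module.finrank ℚ (K i) ≤ 6)
    (Φ : ∀ i, CMType (K i)) :
    CMAlgebra.IsNondegenerateFamily Φ ↔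
      (∀ (i : I) (s₀ : K i →+* ℂ), IsPrimitive (ℂ ≃+* ℂ) (Φ i).1 s₀) ∧
        ∀ (i j : I) (e : K i ≃+* K j), (∀ u : K j →+* ℂ, u ∈ (Φ j).1 ↔ u.comp e.toRingHom ∈ (Φ i).1) → i = j := by
  rw [isNondegenerateFamily_iff_isSeparatingFamily_of_sum_finrank_le_six h6, CMAlgebra.isSeparatingFamily_iff]

end TypeLevel

/-! ## §2 Realisations: `B = D` and the Hodge conjecture on all products -/

section Geometry

variable {I : Type} {K : I → Type} [∀ i, Field (K i)] [∀ i, NumberField (K i)] [∀ i, IsCMField (K i)] [Fintype I]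
  [Nonempty I] {Φ : ∀ i, CMType (K i)}
variable {A : I → AbelianVariety ℂ} {ι : ∀ i, 𝓞 (K i) →+* End (A i)}
  {θ : ∀ i, K i →+* Module.End ℂ (complexBetti (A i).X 1)}

/-- **`Bᵐ ⊗ ℂ = Dᵐ ⊗ ℂ` on every product `⨁_{j<N} A_{π j}`** of realisations of a SEPARATING family of total degree
`Σ_i [K_i:ℚ] ≤ 6` (total dimension `≤ 3`). [cite: MoonenZarhin1999LowDim, §5 (5.2)] [cite: Gordon1999HodgeAVSurvey, 7.5] -/
theorem hodgeClassSpan_prod_eq_divisorClassesSpan_of_isSeparatingFamily_of_sum_finrank_le_six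
    (hsep : CMAlgebra.IsSeparatingFamily Φ) (h6 : ∑ i, Module.finrank ℚ (K i) ≤ 6)
    (hA : ∀ i, IsCMTypeRealisation (Φ i) (A i) (ι i) (θ i)) {N : ℕ} (π : Fin N → I) (m : ℕ) :
    hodgeClassSpan (⨁ fun j : Fin N => A (π j)).dim (⨁ fun j : Fin N => A (π j)).X m =
      divisorClassesSpan (⨁ fun j : Fin N => A (π j)).X (⨁ fun j : Fin N => A (π j)).dim m :=
  (isNondegenerateFamily_of_isSeparatingFamily_of_sum_finrank_le_six hsep h6).hodgeClassSpan_prod_eq_divisorClassesSpan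
    hA π m

/-- **The Hodge conjecture for every product `⨁_{j<N} A_{π j}`** of realisations of a separating family of total
degree `≤ 6`, UNCONDITIONAL. [cite: MoonenZarhin1999LowDim, §5 (5.2)] [cite: Gordon1999HodgeAVSurvey, 10.10] -/
theorem hodgeConjectureFor_prod_of_isSeparatingFamily_of_sum_finrank_le_six (hsep : CMAlgebra.IsSeparatingFamily Φ)
    (h6 : ∑ i, Module.finrank ℚ (K i) ≤ 6) (hA : ∀ i, IsCMTypeRealisation (Φ i) (A i) (ι i) (θ i)) {N : ℕ}
    (π : Fin N → I) : HodgeConjectureFor (⨁ fun j : Fin N => A (π j)).dim (⨁ fun j : Fin N => A (π j)).X :=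
  (isNondegenerateFamily_of_isSeparatingFamily_of_sum_finrank_le_six hsep h6).hodgeConjectureFor_prod hA π

omit [Fintype I] [Nonempty I] [∀ i, IsCMField (K i)] in
/-- The total degree of the fields is twice the total dimension of the realisations (`dim A_i = [K_i:ℚ]/2`,
`[K_i:ℚ]` even). [cite: Shimura1998, §5.1] -/
theorem finrank_eq_two_mul_dim (hA : ∀ i, IsCMTypeRealisation (Φ i) (A i) (ι i) (θ i)) (i : I) :
    Module.finrank ℚ (K i) = 2 * (A i).dim := by
  obtain ⟨n, -, hn⟩ := exists_finrank_eq_two_mul Φ i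
  have hd : (A i).dim = Module.finrank ℚ (K i) / 2 := Literature.AlgebraicGeometry.Motives.schemeDim_eq_holds (hA i).1
  omega

omit [Nonempty I] [∀ i, IsCMField (K i)] in
/-- `Σ_i [K_i:ℚ] = 2 Σ_i dim A_i`. [cite: Shimura1998, §5.1] -/
theorem sum_finrank_eq_two_mul_sum_dim (hA : ∀ i, IsCMTypeRealisation (Φ i) (A i) (ι i) (θ i)) :
    ∑ i, Module.finrank ℚ (K i) = 2 * ∑ i, (A i).dim := by
  rw [Finset.mul_sum]
  exact Finset.sum_congr rfl fun i _ => finrank_eq_two_mul_dim hA i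

/-- **SIMPLE, PAIRWISE NON-ISOGENOUS CM abelian varieties of total dimension `≤ 3` form a NONDEGENERATE family**
(`dim Hg(∏_i A_i) = Σ_i dim A_i`; Moonen–Zarhin (5.2) for CM varieties, the decomposition `X ∼ ∏ Y_i^{m_i}` of (5.1)
being given): the family of their types is separating (`CMAlgebra.isSeparatingFamily_of_isSimple_of_pairwise_not_isIsogenous`:
Shimura §8.2 Prop. 26 and §6.1 Cor.) of total degree `≤ 6`. [cite: MoonenZarhin1999LowDim, §5 (5.1)–(5.2)]
[cite: Gordon1999HodgeAVSurvey, 7.4–7.5] -/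
theorem isNondegenerateFamily_of_isSimple_of_pairwise_not_isIsogenous_of_sum_dim_le_three
    (hA : ∀ i, IsCMTypeRealisation (Φ i) (A i) (ι i) (θ i)) (hs : ∀ i, (A i).IsSimple)
    (hniso : ∀ i j, i ≠ j → ¬ AbelianVariety.IsIsogenous (A i) (A j)) (h3 : ∑ i, (A i).dim ≤ 3) :
    CMAlgebra.IsNondegenerateFamily Φ :=
  isNondegenerateFamily_of_isSeparatingFamily_of_sum_finrank_le_six
    (CMAlgebra.isSeparatingFamily_of_isSimple_of_pairwise_not_isIsogenous hA hs hniso)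
    (by rw [sum_finrank_eq_two_mul_sum_dim hA]; omega)

/-- **`Bᵐ ⊗ ℂ = Dᵐ ⊗ ℂ` on every `∏_i A_i^{k_i}`** for simple, pairwise non-isogenous CM abelian varieties `A_i`
(realisations on `H¹`) of total dimension `≤ 3`: no power and no product of powers supports an exotic Hodge class.
[cite: MoonenZarhin1999LowDim, §5 (5.2)] [cite: Gordon1999HodgeAVSurvey, 7.5] -/
theorem hodgeClassSpan_prod_eq_divisorClassesSpan_of_isSimple_of_pairwise_not_isIsogenous_of_sum_dim_le_three
    (hA : ∀ i, IsCMTypeRealisation (Φ i) (A i) (ι i) (θ i)) (hs : ∀ i, (A i).IsSimple)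
    (hniso : ∀ i j, i ≠ j → ¬ AbelianVariety.IsIsogenous (A i) (A j)) (h3 : ∑ i, (A i).dim ≤ 3) {N : ℕ}
    (π : Fin N → I) (m : ℕ) :
    hodgeClassSpan (⨁ fun j : Fin N => A (π j)).dim (⨁ fun j : Fin N => A (π j)).X m =
      divisorClassesSpan (⨁ fun j : Fin N => A (π j)).X (⨁ fun j : Fin N => A (π j)).dim m :=
  (isNondegenerateFamily_of_isSimple_of_pairwise_not_isIsogenous_of_sum_dim_le_three hA hs hniso h3)
    |>.hodgeClassSpan_prod_eq_divisorClassesSpan hA π m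

/-- **No `∏_i A_i^{k_i}` of simple, pairwise non-isogenous CM abelian varieties of total dimension `≤ 3` supports an
exotic Hodge class.** [cite: MoonenZarhin1999LowDim, §5 (5.2)] [cite: Gordon1999HodgeAVSurvey, 7.5–7.6] -/
theorem not_exists_exceptional_prod_of_isSimple_of_pairwise_not_isIsogenous_of_sum_dim_le_three
    (hA : ∀ i, IsCMTypeRealisation (Φ i) (A i) (ι i) (θ i)) (hs : ∀ i, (A i).IsSimple)
    (hniso : ∀ i j, i ≠ j → ¬ AbelianVariety.IsIsogenous (A i) (A j)) (h3 : ∑ i, (A i).dim ≤ 3) {N : ℕ}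
    (π : Fin N → I) (m : ℕ) :
    ¬∃ c : complexBetti (⨁ fun j : Fin N => A (π j)).X (2 * m), IsRationalClass c ∧
        IsOfHodgeType (⨁ fun j : Fin N => A (π j)).dim (⨁ fun j : Fin N => A (π j)).X (2 * m) m m c ∧
        c ∉ divisorClassesSpan (⨁ fun j : Fin N => A (π j)).X (⨁ fun j : Fin N => A (π j)).dim m :=
  (isNondegenerateFamily_of_isSimple_of_pairwise_not_isIsogenous_of_sum_dim_le_three hA hs hniso h3)
    |>.not_exists_exceptional_prod hA π m

/-- **The Hodge conjecture for every `∏_i A_i^{k_i}`** (every product `⨁_{j<N} A_{π j}`) of SIMPLE, PAIRWISE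
NON-ISOGENOUS complex abelian varieties `A_i` with complex multiplication (realisations of CM types on `H¹`) of total
dimension `Σ_i dim A_i ≤ 3` — UNCONDITIONAL, no hypothesis on the CM fields or types (Moonen–Zarhin (5.2) + Hazama–Murty
for CM varieties; CM elliptic curves, simple CM surfaces, simple CM threefolds and their products of total dimension `≤ 3`).
[cite: MoonenZarhin1999LowDim, §5 (5.2)] [cite: Gordon1999HodgeAVSurvey, 7.5 and 10.10] -/
theorem hodgeConjectureFor_prod_of_isSimple_of_pairwise_not_isIsogenous_of_sum_dim_le_three
    (hA : ∀ i, IsCMTypeRealisation (Φ i) (A i) (ι i) (θ i)) (hs : ∀ i, (A i).IsSimple)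
    (hniso : ∀ i j, i ≠ j → ¬ AbelianVariety.IsIsogenous (A i) (A j)) (h3 : ∑ i, (A i).dim ≤ 3) {N : ℕ}
    (π : Fin N → I) : HodgeConjectureFor (⨁ fun j : Fin N => A (π j)).dim (⨁ fun j : Fin N => A (π j)).X :=
  (isNondegenerateFamily_of_isSimple_of_pairwise_not_isIsogenous_of_sum_dim_le_three hA hs hniso h3)
    |>.hodgeConjectureFor_prod hA π

end Geometry

end Summit.HodgeConjecture.CorCM

end
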